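import Literature.Topology.FourManifolds.SliverRegluingNbhd
import Literature.Topology.FourManifolds.GompfFramedTwistTransport
import HarnessLib

/-!
# The fibre-sliver twist criterion for product-framed surgeries of straightened mapping tori

Seventh brick of the geometric core of R. Gompf, *More Cappell–Shaneson spheres are standard*,
Algebr. Geom. Topol. 10 (2010), Theorem 2.1 (towards the named facts
`Literature.Topology.FourManifolds.gompf2010_framedTwist` /
`Literature.Topology.FourManifolds.gompf2010_framedTwistZero`), in **Gompf's own setting** of a
monodromy `ψ` of `T³` which is the identity near the base point `1` and the surgery of the mapping
torus `X_ψ` along its section circle with the *canonical (product)* framing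
(`Literature.Topology.FourManifolds.prodSurgered`, `GompfFramedTwistTransport.lean`; the framed
Cappell–Shaneson spheres `gompfSphere A γ` are reduced to this setting by straightening, loc. cit.,
`Straightening.nonempty_diffeomorph_gompfSphere_prodSphere`).

Let `g` be a diffeomorphism of `T³` which is the identity off a closed set `S` missing the ball
`expT (B(0, ε))` of the tube (Gompf's Dehn twist `δᵏ` along a collar of the torus `T`,
"supported away from `0` in a neighborhood of a torus", §4 ¶3), and let `X = prodSurgered ψ ε`,
`X' = prodSurgered (g ∘ ψ) ε` ("precede the surgery by cutting along an `M`-fiber and regluing by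
`δᵏ`", proof of Thm 2.1, last paragraph). Write `Σ = inr (S × {1}) ⊂ X_ψ` for the fibre sliver and
`X ∖ Σ` for the surgered manifold minus the sliver
(`(prodTube …).localOpens (sliverCompl inr S _)`).

* `Literature.Topology.FourManifolds.prodTube_mem_sliverCompl` — the product tube misses the
  sliver; `Literature.Topology.FourManifolds.sliverTransport_prodTube` — **the sliver
  diffeomorphism `Θ : X_ψ ∖ Σ ≅ X_{g ∘ ψ} ∖ Σ'` (`MappingTorusSliver.lean`) carries the product
  tube of `X_ψ` onto the product tube of `X_{g ∘ ψ}` on the nose** (the tube lies where `g` is the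
  identity);
* `Literature.Topology.FourManifolds.exists_isOpenGluingWith_prodSurgered_trans` — hence
  **`X'` is an open gluing of `X ∖ Σ` and of any open `V ⊇ S × {1}` of the second cylinder missing
  the fibre through `1`**, along `x ∼ b :⟺ b ∉ S × {1} ∧ x = inl (inr (sliverTwist g⁻¹ b))`
  (`IsOpenGluingWith.sliver_reglue_surgered_opens`, `SliverRegluingNbhd.lean`);
* `Literature.Topology.FourManifolds.prodTwistRel` — that relation, and the **twist criterion**
  `Literature.Topology.FourManifolds.nonempty_diffeomorph_prodSurgered_of_reglue`: if `X` itself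
  is an open gluing of `X ∖ Σ` and `V` along the same relation, then `X ≃ₘ X'` (uniqueness of open
  gluings) — this is the last paragraph of Gompf's proof ("It follows that `X^ε_φ` is unchanged if
  we cut along this face and reglue by the given Dehn twist"), the hypothesis being what the
  fishtail neighbourhood and Lemma 2.2 deliver;
* `Literature.Topology.FourManifolds.nonempty_diffeomorph_prodSurgered_of_twistingDiffeo` — the
  same from a diffeomorphism `G` of `X ∖ Σ` with `G (inl (inr b)) = inl (inr (sliverTwist g b))` on
  `V` off the sliver (`IsOpenGluingWith.reglue_of_sliverTwisting`).

Compared with `GompfTwistTransport.lean` (the same for the tree's `gompfSphere B β` with its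
`β`-twisted tube and linear monodromy) no tube computation, rescaling or straightening class is
needed here: in Gompf's setting the transported tube *is* the product tube.

No named facts are introduced; everything is proved.

## References

* R. E. Gompf, *More Cappell–Shaneson spheres are standard*, Algebr. Geom. Topol. 10 (2010)
  1665–1681: §2 ¶1 (the setting), Thm 2.1 (proof, last paragraph), Lemma 2.2, §4 ¶3.
  [GompfAGT2010]
-/

open scoped Manifold ContDiff Topology Real
open Set Function Metric

noncomputable section

namespace Literature.Topology.FourManifolds

/-- Local notation: `𝔼 n` is the model Euclidean space `EuclideanSpace ℝ (Fin n)`. -/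
local notation "𝔼 " n:arg => EuclideanSpace ℝ (Fin n)

/-- Local notation: `𝕊 n` is the unit sphere in `EuclideanSpace ℝ (Fin (n + 1))`. -/
local notation "𝕊 " n:arg => (Metric.sphere (0 : EuclideanSpace ℝ (Fin (n + 1))) 1)

/-- Local notation: the model with corners `𝓣 = (𝓡 1).prod ((𝓡 1).prod (𝓡 1))` of `ThreeTorus`. -/
local notation "𝓣" =>
  (ModelWithCorners.prod (𝓡 1) (ModelWithCorners.prod (𝓡 1) (𝓡 1)))

attribute [local instance] fact_finrank_euclideanSpace_succ

section Setting

variable (ψ : ThreeTorus ≃ₘ⟮𝓣, 𝓣⟯ ThreeTorus) {ε : ℝ} (hε : 0 < ε) (hεπ : ε ≤ π)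
  (hψ : ∀ v : 𝔼 3, ‖v‖ < ε → ψ (expT v) = expT v)
  (g : ThreeTorus ≃ₘ⟮𝓣, 𝓣⟯ ThreeTorus) {S : Set ThreeTorus} (hS : IsClosed S)
  (hgS : ∀ y ∉ S, g y = y) (hSε : ∀ v : 𝔼 3, ‖v‖ < ε → expT v ∉ S)

/-! ### The twisted monodromy and the two mapping tori -/

include hψ hgS hSε in
/-- **`g ∘ ψ` is again the identity near `1`** (the tube ball misses the support of `g`). [cite: GompfAGT2010, §4 ¶3 (δ^k ∘ A is well-defined since δ is supported away from 0)] -/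
theorem trans_apply_expT_of_norm_lt (v : 𝔼 3) (hv : ‖v‖ < ε) : (ψ.trans g) (expT v) = expT v := by
  rw [Diffeomorph.coe_trans, comp_apply, hψ v hv, hgS _ (hSε v hv)]

/-- `X_ψ` is a mapping torus of `ψ` (canonical witnesses). [folklore] -/
theorem isOpenGluingWith_mTorus :
    IsOpenGluingWith (ModelWithCorners.prod 𝓣 𝓘(ℝ, ℝ)) (ModelWithCorners.prod 𝓣 𝓘(ℝ, ℝ)) (𝓡 4)
      (mappingTorusRel ⇑ψ) (mtGlueData ψ).inl (mtGlueData ψ).inr :=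
  isOpenGluingWith_mappingTorusGlued ψ linTorusModel

/-- `X_{g ∘ ψ}` is a mapping torus of `g ∘ ψ` (canonical witnesses). [folklore] -/
theorem isOpenGluingWith_mTorus_trans :
    IsOpenGluingWith (ModelWithCorners.prod 𝓣 𝓘(ℝ, ℝ)) (ModelWithCorners.prod 𝓣 𝓘(ℝ, ℝ)) (𝓡 4)
      (mappingTorusRel (⇑g ∘ ⇑ψ)) (mtGlueData (ψ.trans g)).inl (mtGlueData (ψ.trans g)).inr :=
  isOpenGluingWith_mappingTorusGlued (ψ.trans g) linTorusModel

include hS in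
/-- In the compact `T³` a closed support is compact, so the sliver image in `X_ψ` is closed. [folklore] -/
theorem isClosed_image_fibreSliver_mTorus :
    IsClosed ((mtGlueData ψ).inr '' fibreSliver S) :=
  isClosed_image_fibreSliver (mtGlueData ψ).continuous_inr hS.isCompact

/-- **The complement `X_ψ ∖ Σ` of the sliver `Σ = inr (S × {1})`.** [cite: GompfAGT2010, Thm 2.1 (proof, last paragraph: "cut along this face")] -/
def prodSliverCompl : TopologicalSpace.Opens (MTorus ψ) :=
  sliverCompl (mtGlueData ψ).inr S (isClosed_image_fibreSliver_mTorus ψ hS)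

/-! ### The product tube misses the sliver and is transported to the product tube -/

include hSε in
/-- **The product tube misses the sliver**: no point of the tube over the first cylinder is glued
to the level `t = 1`, and over the second cylinder the tube fibres `expT (B(0, ε))` miss `S`. [folklore] -/
theorem prodTube_mem_sliverCompl (q : (𝕊 1) × (𝔼 3)) :
    (prodTube ψ ε hε hεπ hψ).toFun q ∈ prodSliverCompl ψ hS := by
  rw [prodSliverCompl, mem_sliverCompl_iff]
  rintro ⟨b, hb, hq⟩
  obtain ⟨u, w⟩ := q
  by_cases hu : u = ptB
  · have hA : u ≠ ptA := hu ▸ ptA_ne_ptB.symm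
    rw [prodTube_apply_of_ne ψ ε hε hεπ hψ hA, eq_comm, mappingTorusGlued_inl_eq_inr_iff] at hq
    exact not_mappingTorusRel_of_coe_snd_eq_one _ _ hb.2 hq
  · rw [prodTube_apply_of_ne_ptB ψ ε hε hεπ hψ hu] at hq
    have hb1 : b.1 = expT ((TubeTwist.const ε hε hεπ).shrink w) :=
      congrArg Prod.fst ((mtGlueData ψ).inr_injective hq)
    exact hSε _ (TubeTwist.norm_shrink_const_lt hε hεπ w) (hb1 ▸ hb.1)

variable (hc' : IsClosed ((mtGlueData (ψ.trans g)).inr '' fibreSliver S))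
  (Θ : ↥(prodSliverCompl ψ hS) ≃ₘ⟮𝓡 4, 𝓡 4⟯ ↥(sliverCompl (mtGlueData (ψ.trans g)).inr S hc'))
  (hΘA : ∀ (x : ↥(prodSliverCompl ψ hS)) (a : ThreeTorus × ↥mappingTorusPieceOne),
    (x : MTorus ψ) = (mtGlueData ψ).inl a →
      (Θ x : MTorus (ψ.trans g)) = (mtGlueData (ψ.trans g)).inl a)
  (hΘB : ∀ (x : ↥(prodSliverCompl ψ hS)) (b : ThreeTorus × ↥mappingTorusPieceTwo),
    (x : MTorus ψ) = (mtGlueData ψ).inr b →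
      (Θ x : MTorus (ψ.trans g)) = (mtGlueData (ψ.trans g)).inr (sliverTwist g b))

include hgS hSε hΘA hΘB in
/-- **The sliver diffeomorphism carries the product tube of `X_ψ` onto the product tube of
`X_{g ∘ ψ}`** (over the first cylinder `Θ ∘ inl = inl'`; over the second `Θ ∘ inr = inr' ∘ sliverTwist g`
and `g` fixes the tube fibres). [cite: GompfAGT2010, Thm 2.1 (proof, last paragraph)] -/
theorem sliverTransport_prodTube (q : (𝕊 1) × (𝔼 3)) :
    ((Θ ⟨(prodTube ψ ε hε hεπ hψ).toFun q, prodTube_mem_sliverCompl ψ hε hεπ hψ hS hSε q⟩ :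
        ↥(sliverCompl (mtGlueData (ψ.trans g)).inr S hc')) : MTorus (ψ.trans g)) =
      (prodTube (ψ.trans g) ε hε hεπ (trans_apply_expT_of_norm_lt ψ hψ g hgS hSε)).toFun q := by
  obtain ⟨u, w⟩ := q
  by_cases hu : u = ptA
  · subst hu
    rw [hΘB _ _ (prodTube_apply_of_ne_ptB ψ ε hε hεπ hψ ptA_ne_ptB w),
      prodTube_apply_of_ne_ptB _ ε hε hεπ _ ptA_ne_ptB w,
      sliverTwist_eq_self (g := (g : ThreeTorus → ThreeTorus)) hgS
        (hSε _ (TubeTwist.norm_shrink_const_lt hε hεπ w))]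
  · rw [hΘA _ _ (prodTube_apply_of_ne ψ ε hε hεπ hψ hu w), prodTube_apply_of_ne _ ε hε hεπ _ hu w]

/-! ### The twisted surgery is an open gluing of `X ∖ Σ` and a neighbourhood of the sliver -/

/-- A point of the second cylinder of `X_φ` with `b.1 ≠ 1` is off the base section, for a
monodromy fixing `1`. [folklore] -/
theorem inr_not_mem_range_secCircle {φ : ThreeTorus ≃ₘ⟮𝓣, 𝓣⟯ ThreeTorus} (P : TubeTwistPair φ)
    (hφ : φ 1 = 1) {b : ThreeTorus × ↥mappingTorusPieceTwo} (hb : b.1 ≠ 1) :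
    (mtGlueData φ).inr b ∉ range P.secCircle := by
  rw [P.range_secCircle]
  rintro (⟨a, ha, hab⟩ | ⟨b', hb', hbb⟩)
  · obtain ⟨ha1, -⟩ := mem_prod.1 ha
    rw [mem_singleton_iff] at ha1
    rcases (mappingTorusGlued_inl_eq_inr_iff _ _ a _).1 hab with ⟨-, h⟩ | ⟨-, h⟩
    · exact hb (by rw [h, ha1])
    · exact hb (by rw [h, ha1, hφ])
  · obtain ⟨hb1, -⟩ := mem_prod.1 hb'
    rw [mem_singleton_iff] at hb1
    exact hb (by rw [← (mtGlueData φ).inr_injective hbb, hb1])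

/-! ### The twist relation and the criterion -/

include hε hψ hgS hSε in
/-- `g ∘ ψ` fixes the base point `1 = expT 0`. [folklore] -/
theorem trans_apply_one : (ψ.trans g) 1 = 1 := by
  have h := trans_apply_expT_of_norm_lt ψ hψ g hgS hSε 0 (by simpa using hε)
  rwa [expT_zero] at h

variable (V : TopologicalSpace.Opens (ThreeTorus × ↥mappingTorusPieceTwo))

include hε hψ hgS hSε in
/-- Points of `V` (which misses the fibre through `1`) are off the base section of `X_{g ∘ ψ}`. [folklore] -/
theorem inr_not_mem_range_secCircle_trans (hV1 : ∀ b ∈ V, b.1 ≠ 1)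
    (b : ThreeTorus × ↥mappingTorusPieceTwo) (hb : b ∈ V) :
    (mtGlueData (ψ.trans g)).inr b ∉
      range (prodPair (ψ.trans g) ε hε hεπ (trans_apply_expT_of_norm_lt ψ hψ g hgS hSε)).secCircle :=
  inr_not_mem_range_secCircle _ (trans_apply_one ψ hε hψ g hgS hSε) (hV1 b hb)

include hψ in
/-- Points of `V` are off the base section of `X_ψ`. [folklore] -/
theorem inr_not_mem_range_secCircle_self (hV1 : ∀ b ∈ V, b.1 ≠ 1)
    (b : ThreeTorus × ↥mappingTorusPieceTwo) (hb : b ∈ V) :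
    (mtGlueData ψ).inr b ∉ range (prodPair ψ ε hε hεπ hψ).secCircle := by
  refine inr_not_mem_range_secCircle _ ?_ (hV1 b hb)
  have h := hψ 0 (by simpa using hε)
  rwa [expT_zero] at h

/-- **The twist relation of `X = prodSurgered ψ ε` across the sliver** (Gompf 2010, Thm 2.1 /
Lemma 2.2, in the tree's relational language): between the surgered open set `X ∖ Σ`
(`(prodTube ψ ε …).localOpens (X_ψ ∖ inr (S × {1}))`) and a neighbourhood `V` of the sliver in the
second cylinder: `x ∼ b :⟺ b ∉ S × {1} ∧ x = inl (inr (sliverTwist g⁻¹ b))` — "cut along an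
`M`-fiber and reglue by `δ`". Theorem 2.1 is the statement that `X` itself carries an open gluing
along this relation (hypothesis `hX` of `nonempty_diffeomorph_prodSurgered_of_reglue`); Lemma 2.2
provides it through a diffeomorphism of `X ∖ Σ` twisting across the sliver
(`nonempty_diffeomorph_prodSurgered_of_twistingDiffeo`). [cite: GompfAGT2010, Thm 2.1 (proof) and Lemma 2.2] -/
def prodTwistRel (x : ↥((prodTube ψ ε hε hεπ hψ).localOpens (prodSliverCompl ψ hS))) (b : ↥V) :
    Prop :=
  (b : ThreeTorus × ↥mappingTorusPieceTwo) ∉ fibreSliver S ∧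
    ∃ a : ↥(prodTube ψ ε hε hεπ hψ).complement,
      (a : MTorus ψ) = (mtGlueData ψ).inr (sliverTwist g.symm b) ∧
        (x : prodSurgered ψ ε hε hεπ hψ) = (prodTube ψ ε hε hεπ hψ).glueData.inl a

/-- **The twisted surgery `X' = prodSurgered (g ∘ ψ) ε` is an open gluing of `X ∖ Σ` and `V` along
the twist relation** — by the sliver diffeomorphism `Θ` (`IsOpenGluingWith.exists_sliverDiffeomorph`),
its extension over the surgery (`CircleNbhd.exists_diffeomorph_localOpens`), and
`IsOpenGluingWith.sliver_reglue_surgered_opens`, the transported tube being the product tube of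
`X_{g ∘ ψ}` (`sliverTransport_prodTube`). [cite: GompfAGT2010, Thm 2.1 (proof, last paragraph: "precede the surgery by cutting along an M-fiber and regluing by δ^k")] -/
theorem exists_isOpenGluingWith_prodSurgered_trans (hVS : fibreSliver S ⊆ V) (hV1 : ∀ b ∈ V, b.1 ≠ 1) :
    ∃ (eU : ↥((prodTube ψ ε hε hεπ hψ).localOpens (prodSliverCompl ψ hS)) →
        prodSurgered (ψ.trans g) ε hε hεπ (trans_apply_expT_of_norm_lt ψ hψ g hgS hSε))
      (eV : ↥V → prodSurgered (ψ.trans g) ε hε hεπ (trans_apply_expT_of_norm_lt ψ hψ g hgS hSε)),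
      IsOpenGluingWith (𝓡 4) (ModelWithCorners.prod 𝓣 𝓘(ℝ, ℝ)) (𝓡 4)
        (prodTwistRel ψ hε hεπ hψ g hS V) eU eV := by
  have hc' : IsClosed ((mtGlueData (ψ.trans g)).inr '' fibreSliver S) :=
    isClosed_image_fibreSliver_mTorus (ψ.trans g) hS
  obtain ⟨Θ, hΘA, hΘB⟩ := (isOpenGluingWith_mTorus ψ).exists_sliverDiffeomorph g
    (isOpenGluingWith_mTorus_trans ψ g) hS hgS (isClosed_image_fibreSliver_mTorus ψ hS) hc'
  have hνU := prodTube_mem_sliverCompl ψ hε hεπ hψ hS hSε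
  have hΘν := sliverTransport_prodTube ψ hε hεπ hψ g hS hgS hSε hc' Θ hΘA hΘB
  obtain ⟨Ψ, hΨl, hΨr⟩ := CircleNbhd.exists_diffeomorph_localOpens (prodTube ψ ε hε hεπ hψ)
    (prodTube (ψ.trans g) ε hε hεπ (trans_apply_expT_of_norm_lt ψ hψ g hgS hSε)) Θ hνU hΘν
  have hVc : ∀ b ∈ V, (mtGlueData (ψ.trans g)).inr b ∉
      range (prodPair (ψ.trans g) ε hε hεπ (trans_apply_expT_of_norm_lt ψ hψ g hgS hSε)).secCircle :=
    inr_not_mem_range_secCircle_trans ψ hε hεπ hψ g hgS hSε V hV1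
  exact ⟨_, _, (isOpenGluingWith_mTorus ψ).sliver_reglue_surgered_opens g
    (isOpenGluingWith_mTorus_trans ψ g) (isClosed_image_fibreSliver_mTorus ψ hS) hc' Θ hΘA hΘB
    (prodTube ψ ε hε hεπ hψ) (prodTube (ψ.trans g) ε hε hεπ _) hνU hΘν Ψ hΨl hΨr V hVS hVc⟩

/-- **The twist criterion for product-framed surgeries (Gompf's Theorem 2.1, relational form).**
Let `ψ` be a monodromy of `T³` which is the identity on `expT (B(0, ε))`, `g` a diffeomorphism of
`T³` which is the identity off a closed `S` missing that ball, `V ⊇ S × {1}` an open set of the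
second cylinder missing the fibre through `1`. If `X = prodSurgered ψ ε` is an open gluing of
`X ∖ Σ` and `V` along the twist relation — which is what the fishtail neighbourhood and Lemma 2.2
of Gompf's proof provide: "`X^ε_φ` is unchanged if we cut along this face and reglue by the given
Dehn twist" — then `X ≃ₘ X' = prodSurgered (g ∘ ψ) ε` ("we have produced a diffeomorphism from
`X^ε_φ` to `X^ε_{φ∘δᵏ}`"): both are open gluings along the same relation
(`exists_isOpenGluingWith_prodSurgered_trans`), hence diffeomorphic by uniqueness of open gluings. [cite: GompfAGT2010, Thm 2.1 (proof, last paragraph)] -/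
theorem nonempty_diffeomorph_prodSurgered_of_reglue (hVS : fibreSliver S ⊆ V) (hV1 : ∀ b ∈ V, b.1 ≠ 1)
    (hX : ∃ (eU : ↥((prodTube ψ ε hε hεπ hψ).localOpens (prodSliverCompl ψ hS)) →
        prodSurgered ψ ε hε hεπ hψ) (eV : ↥V → prodSurgered ψ ε hε hεπ hψ),
      IsOpenGluingWith (𝓡 4) (ModelWithCorners.prod 𝓣 𝓘(ℝ, ℝ)) (𝓡 4)
        (prodTwistRel ψ hε hεπ hψ g hS V) eU eV) :
    Nonempty (prodSurgered ψ ε hε hεπ hψ ≃ₘ⟮𝓡 4, 𝓡 4⟯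
      prodSurgered (ψ.trans g) ε hε hεπ (trans_apply_expT_of_norm_lt ψ hψ g hgS hSε)) := by
  obtain ⟨eU, eV, hXw⟩ := hX
  obtain ⟨eU', eV', hX'⟩ := exists_isOpenGluingWith_prodSurgered_trans ψ hε hεπ hψ g hS hgS hSε V
    hVS hV1
  obtain ⟨e, -, -⟩ := hXw.exists_diffeomorph_apply_eq hX'
  exact ⟨e⟩

/-- **The twist criterion from a twisting diffeomorphism** (the form in which Lemma 2.2 delivers
Theorem 2.1): if some diffeomorphism `G` of `X ∖ Σ` satisfies
`G (inl (inr b)) = inl (inr (sliverTwist g b))` for `b ∈ V` off the sliver, then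
`prodSurgered ψ ε ≃ₘ prodSurgered (g ∘ ψ) ε` (`IsOpenGluingWith.reglue_of_sliverTwisting` and
`nonempty_diffeomorph_prodSurgered_of_reglue`). [cite: GompfAGT2010, Lemma 2.2 and Thm 2.1 (proof, last paragraph)] -/
theorem nonempty_diffeomorph_prodSurgered_of_twistingDiffeo (hVS : fibreSliver S ⊆ V)
    (hV1 : ∀ b ∈ V, b.1 ≠ 1) (hVg : ∀ b ∈ V, sliverTwist g.symm b ∈ V)
    (G : ↥((prodTube ψ ε hε hεπ hψ).localOpens (prodSliverCompl ψ hS)) ≃ₘ⟮𝓡 4, 𝓡 4⟯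
      ↥((prodTube ψ ε hε hεπ hψ).localOpens (prodSliverCompl ψ hS)))
    (hG : ∀ (x : ↥((prodTube ψ ε hε hεπ hψ).localOpens (prodSliverCompl ψ hS))) (b : ↥V),
      (b : ThreeTorus × ↥mappingTorusPieceTwo) ∉ fibreSliver S →
        (x : prodSurgered ψ ε hε hεπ hψ) = (prodTube ψ ε hε hεπ hψ).glueData.inl
          (opensToComplement (prodTube ψ ε hε hεπ hψ) (mtGlueData ψ).inr V
            (inr_not_mem_range_secCircle_self ψ hε hεπ hψ V hV1) b) →
          ∃ a' : ↥(prodTube ψ ε hε hεπ hψ).complement,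
            (a' : MTorus ψ) = (mtGlueData ψ).inr (sliverTwist g b) ∧
              (G x : prodSurgered ψ ε hε hεπ hψ) = (prodTube ψ ε hε hεπ hψ).glueData.inl a') :
    Nonempty (prodSurgered ψ ε hε hεπ hψ ≃ₘ⟮𝓡 4, 𝓡 4⟯
      prodSurgered (ψ.trans g) ε hε hεπ (trans_apply_expT_of_norm_lt ψ hψ g hgS hSε)) :=
  nonempty_diffeomorph_prodSurgered_of_reglue ψ hε hεπ hψ g hS hgS hSε V hVS hV1 ⟨_, _,
    (isOpenGluingWith_mTorus ψ).reglue_of_sliverTwisting g (g' := g.symm)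
      (fun y ↦ g.apply_symm_apply y) (isClosed_image_fibreSliver_mTorus ψ hS)
      (prodTube ψ ε hε hεπ hψ) (prodTube_mem_sliverCompl ψ hε hεπ hψ hS hSε) V hVS
      (inr_not_mem_range_secCircle_self ψ hε hεπ hψ V hV1) hVg G hG⟩

end Setting

end Literature.Topology.FourManifolds
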